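import Summits.HodgeConjecture.HodgeConjecture.Theorems.F0P3cStCharTSVanDijkBox        -- ★ p851676 (LH6-p03 g5) (J3) «N-COMMUTATOR BOX BIJECTION»: `bijOn_vanDijk_box`, `image_conj_box`, `injOn_vanDijk`; brings ★ TN-CONJ §4 (`weyl_mul_self`, `weyl_inv_eq`), ★ WeylHypTorsor (`isRegularElt_coe_conj_iff`)
import Literature.NumberTheory.Automorphic.CMBorelWeylTorusConjugate                    -- ★ `weylConj_mem_torusU` (`ʷt ∈ T`), `glDiagonal_rev_eq_weylConj` (`ʷ(diag d) = diag (d ∘ rev)`)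
import HarnessLib

/-!
# F0 · P3c · line LH6 «StCharTS» — ROAD «JAC-LOC» brick (J3⁻) «N⁻-COMMUTATOR BOX BIJECTION (Weyl twin)»: for a REGULAR diagonal `t`, van Dijk's map on `N⁻ = w₀ N w₀⁻¹`
# is a bijection between the `w₀`-conjugates of valuation boxes, scaling by the root scalars `d₂⁻¹d₁ − 1`, `d₂⁻¹d₀ − 1` of `ʷt = diag(d₂, d₁, d₀)`
# (Harish-Chandra 1970 Lemma 22; van Dijk 1972 §2; Rogawski 1990 §12.5 p. 182)

Cell `pub/hodgecm-mathlib`, crux H413 = `stmt-HodgeConjecture-24833` (lane `--supports … --as helper`), route HCCMUnconditional; seat LH6-p02 (g6), brick (J3⁻) of the road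
«JAC-LOC» (holder LH6-p03 (g5); brick list F0∕P3b 2026-09-02T14:11:30Z, interface 14:17:59Z, memo `F0/P3b/LH6-p03/g5/ROAD-JAC-LOC.v1.LH6p03g5.md` §2).  THEOREMS ONLY,
sorry-free, no definition ∕ instance ∕ notation ∕ named fact; imports ★ (J3) + ★ `CMBorelWeylTorusConjugate` + HarnessLib.
SETTING = ★ (J3)'s generic one: `U = ↥(unitaryGroupOfForm σ J)` over a commutative ring `R` with an involution `σ` (`hσ`) and `2 ∈ Rˣ`, `J = Φ₃` (`hJ`), `T = torusU σ J`,
`N = unipotentU σ J` with the ★ Heisenberg chart (`heisX`, `heisY`), any valuation `v : Valuation R Γ₀` with `hv : v ∘ σ = v`, and a Weyl element `w₀ ∈ U` with matrix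
`Φ₃` (`hw₀ : ↑↑w₀ = J`; `w₀² = 1`, ★ `weyl_mul_self`).  For `t = diag(d) ∈ T`: `ʷt := w₀ t w₀⁻¹ = diag(d₂, d₁, d₀) ∈ T` (★ `glDiagonal_rev_eq_weylConj`), regular iff `t` is
(★ `isRegularElt_coe_conj_iff`); its root scalars are `a_w = d₂⁻¹d₁` (`= σ(a)⁻¹ = σ(a⁻¹)`) and `b_w = d₂⁻¹d₀` (`= b⁻¹`), read DIRECTLY on `d`.
THE RESULTS — ★ (J3) at `ʷt`, conjugated back by `w₀` (`(w₀ m′ w₀⁻¹) t (w₀ m′ w₀⁻¹)⁻¹ = w₀ (m′ ʷt m′⁻¹) w₀⁻¹`, `t (w₀ n w₀⁻¹) = w₀ (ʷt n) w₀⁻¹`):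
* `weyl_conj_weylConj` — `w₀ (w₀ g w₀⁻¹) w₀⁻¹ = g`;
* **`image_weylConj_conj_box`** — for regular `t` and radii with the depth condition of (J3) AT `(a_w, b_w)`:
  `{(w₀ m′ w₀⁻¹) t (w₀ m′ w₀⁻¹)⁻¹ : m′ ∈ BOX(ρx, ρy)} = t · w₀ · BOX(v(a_w − 1)ρx, v(b_w − 1)ρy) · w₀⁻¹` in `U` (the `N⁻`-half of the road's ORBIT-TUBE identity (J4));
* **`bijOn_weylConj_vanDijk_box`** — the `Set.BijOn` form: `g ↦ t⁻¹ g t g⁻¹` is a bijection from `w₀·BOX(ρx, ρy)·w₀⁻¹` onto `w₀·BOX(v(a_w − 1)ρx, v(b_w − 1)ρy)·w₀⁻¹`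
  (★ (J3) `bijOn_vanDijk_box` at `ʷt` transported along the injection `m ↦ w₀ m w₀⁻¹`, Mathlib `Set.bijOn_image_image`).
HONEST LABEL: count-neutral algebra for the road «JAC-LOC» (hyperbolic half of the print residue «WIF» of the (S-𝔇) organ `stub_EllipticPackage` of
`Cruxes/H413/Lines/F0_P3c_StCharTSPaydown.lean`); closes no organ.  HC_CM is proved only modulo the 7 printed citations (2 remaining: hLiu418 =
`stmt-HodgeConjecture-24832`, h413 = `stmt-HodgeConjecture-24833`) until rung 0 closes.

## References
* [HarishChandra1970] Harish-Chandra, *Harmonic analysis on reductive p-adic groups*, LNM 162 (1970), Lemma 22 (the Jacobian of `(x, t) ↦ x t x⁻¹`).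
* [vanDijk1972] G. van Dijk, *Computation of certain induced characters of p-adic groups*, Math. Ann. 199 (1972) 229–240, §2 (`n ↦ t⁻¹ n⁻¹ t n` on `N`, and on `N̄`).
* [Rogawski1990] J. D. Rogawski, *Automorphic Representations of Unitary Groups in Three Variables*, Ann. of Math. Stud. 123 (1990), §1.10 p. 9 (`N`, `M`, the Weyl element),
  §12.5 p. 182 (Weyl integration formula), Lemma 12.7.1 p. 191.
-/

set_option autoImplicit false
-- the mandated namespace has the single-problem summit's repeated segment (`HodgeConjecture.HodgeConjecture`)
set_option linter.dupNamespace false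

open Matrix
open Literature.NumberTheory.Automorphic Literature.NumberTheory.Automorphic.UnitaryGroup Literature.NumberTheory.Automorphic.UnitaryGroup.HeisRing
open Literature.NumberTheory.Rogawski1990
open Summit.HodgeConjecture.HodgeConjecture.Cruxes.H413.F0P3cStCharTSTorusUnipotentConj
open Summit.HodgeConjecture.HodgeConjecture.Cruxes.H413.F0P3cStCharTSWeylHypTorsor
open Summit.HodgeConjecture.HodgeConjecture.Cruxes.H413.F0P3cStCharTSVanDijkBox
open scoped MatrixGroups

namespace Summit.HodgeConjecture.HodgeConjecture.Cruxes.H413.F0P3cStCharTSVanDijkBoxOpp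

variable {R : Type*} [CommRing R] (σ : R →+* R) (hσ : ∀ x, σ (σ x) = x) {J : Matrix (Fin 3) (Fin 3) R}
  (hJ : J = (StdForm.antidiagonal 3).over R)
  {Γ₀ : Type*} [LinearOrderedCommGroupWithZero Γ₀] (v : Valuation R Γ₀) (hv : ∀ x, v (σ x) = v x)
  (w₀ : ↥(unitaryGroupOfForm σ J)) (hw₀ : ((w₀ : GL (Fin 3) R) : Matrix (Fin 3) (Fin 3) R) = J)

/-! ## §1 Conjugating by the Weyl element -/

include hw₀ hJ in
/-- `w₀ (w₀ g w₀⁻¹) w₀⁻¹ = g` (`w₀² = 1`, ★ `weyl_mul_self`). [cite: Rogawski1990, §1.10 p. 9] -/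
theorem weyl_conj_weylConj (g : ↥(unitaryGroupOfForm σ J)) : w₀ * (w₀ * g * w₀⁻¹) * w₀⁻¹ = g := by
  have h2 := weyl_mul_self σ hJ hw₀
  calc w₀ * (w₀ * g * w₀⁻¹) * w₀⁻¹ = (w₀ * w₀) * g * (w₀ * w₀)⁻¹ := by group
    _ = g := by rw [h2, inv_one, one_mul, mul_one]

include hw₀ hJ in
/-- `(w₀ m′ w₀⁻¹) t (w₀ m′ w₀⁻¹)⁻¹ = w₀ (m′ ʷt m′⁻¹) w₀⁻¹` with `ʷt = w₀ t w₀⁻¹` (`w₀⁻¹ = w₀`, ★ `weyl_inv_eq`). [cite: Rogawski1990, §1.10 p. 9] -/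
theorem weylConj_mul_conj_eq (t g : ↥(unitaryGroupOfForm σ J)) :
    (w₀ * g * w₀⁻¹) * t * (w₀ * g * w₀⁻¹)⁻¹ = w₀ * (g * (w₀ * t * w₀⁻¹) * g⁻¹) * w₀⁻¹ := by
  have hwi := weyl_inv_eq σ hJ hw₀
  calc (w₀ * g * w₀⁻¹) * t * (w₀ * g * w₀⁻¹)⁻¹ = w₀ * g * (w₀⁻¹ * t * w₀) * g⁻¹ * w₀⁻¹ := by group
    _ = w₀ * (g * (w₀ * t * w₀⁻¹) * g⁻¹) * w₀⁻¹ := by rw [hwi]; group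

include hw₀ hJ in
/-- `t (w₀ n w₀⁻¹) = w₀ (ʷt n) w₀⁻¹`. [cite: Rogawski1990, §1.10 p. 9] -/
theorem mul_weylConj_eq (t g : ↥(unitaryGroupOfForm σ J)) :
    t * (w₀ * g * w₀⁻¹) = w₀ * ((w₀ * t * w₀⁻¹) * g) * w₀⁻¹ := by
  have h2 := weyl_mul_self σ hJ hw₀
  calc t * (w₀ * g * w₀⁻¹) = (w₀ * w₀) * t * (w₀ * w₀)⁻¹ * (w₀ * g * w₀⁻¹) := by rw [h2, inv_one, one_mul, mul_one]
    _ = w₀ * ((w₀ * t * w₀⁻¹) * g) * w₀⁻¹ := by group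

include hw₀ hJ in
/-- `t⁻¹ (w₀ g w₀⁻¹) t (w₀ g w₀⁻¹)⁻¹ = w₀ (ʷt⁻¹ g ʷt g⁻¹) w₀⁻¹` — van Dijk's map on `N⁻` is the `w₀`-conjugate of van Dijk's map at `ʷt` (★ `coe_torusConj`).
[cite: vanDijk1972, §2] -/
theorem vanDijk_weylConj_eq (t g : ↥(unitaryGroupOfForm σ J)) :
    t⁻¹ * (w₀ * g * w₀⁻¹) * t * (w₀ * g * w₀⁻¹)⁻¹ = w₀ * ((w₀ * t * w₀⁻¹)⁻¹ * g * (w₀ * t * w₀⁻¹) * g⁻¹) * w₀⁻¹ := by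
  have hwi := weyl_inv_eq σ hJ hw₀
  calc t⁻¹ * (w₀ * g * w₀⁻¹) * t * (w₀ * g * w₀⁻¹)⁻¹ = w₀ * ((w₀⁻¹ * t * w₀)⁻¹ * g * (w₀⁻¹ * t * w₀) * g⁻¹) * w₀⁻¹ := by group
    _ = w₀ * ((w₀ * t * w₀⁻¹)⁻¹ * g * (w₀ * t * w₀⁻¹) * g⁻¹) * w₀⁻¹ := by rw [hwi]

/-! ## §2 (J3⁻) The `N⁻` box bijection -/

variable [Invertible (2 : R)]

include hσ hv hw₀ in
/-- **(J3⁻) THE `N⁻` BOX IDENTITY read in `U`** (`N⁻ = w₀ N w₀⁻¹`): for REGULAR `t = diag(d) ∈ T` and radii with the depth condition of ★ (J3) AT THE ROOT SCALARS OF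
`ʷt = diag(d₂, d₁, d₀)` (`a_w = d₂⁻¹d₁`, `b_w = d₂⁻¹d₀`): `{(w₀ m′ w₀⁻¹) t (w₀ m′ w₀⁻¹)⁻¹ : m′ ∈ BOX(ρx, ρy)} = t · w₀ · BOX(v(a_w − 1)ρx, v(b_w − 1)ρy) · w₀⁻¹` —
★ `image_conj_box` at `ʷt`, conjugated back by `w₀`. [cite: HarishChandra1970, Lemma 22] [cite: vanDijk1972, §2] [cite: Rogawski1990, §12.5 p. 182; Lemma 12.7.1 p. 191] -/
theorem image_weylConj_conj_box (t : ↥(torusU σ J)) (hreg : IsRegularElt ((t : ↥(unitaryGroupOfForm σ J)) : GL (Fin 3) R))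
    {d : Fin 3 → Rˣ} (hd : glDiagonal 3 R d = ((t : ↥(unitaryGroupOfForm σ J)) : GL (Fin 3) R)) {ρx ρy : Γ₀}
    (hρ : v (⅟(2 : R)) * v ((((d 2)⁻¹ * d 1 : Rˣ) : R) - σ (((d 2)⁻¹ * d 1 : Rˣ) : R)) * (ρx * ρx) ≤ v ((((d 2)⁻¹ * d 0 : Rˣ) : R) - 1) * ρy) :
    (fun m' : ↥(unipotentU σ J) =>
        (w₀ * (m' : ↥(unitaryGroupOfForm σ J)) * w₀⁻¹) * t * (w₀ * (m' : ↥(unitaryGroupOfForm σ J)) * w₀⁻¹)⁻¹) ''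
        {m' | v (heisX σ m') ≤ ρx ∧ v (heisY σ hσ hJ m' : R) ≤ ρy} =
      (fun n : ↥(unipotentU σ J) => (t : ↥(unitaryGroupOfForm σ J)) * (w₀ * (n : ↥(unitaryGroupOfForm σ J)) * w₀⁻¹)) ''
        {n | v (heisX σ n) ≤ v ((((d 2)⁻¹ * d 1 : Rˣ) : R) - 1) * ρx ∧ v (heisY σ hσ hJ n : R) ≤ v ((((d 2)⁻¹ * d 0 : Rˣ) : R) - 1) * ρy} := by
  -- the reflected torus element `ʷt = w₀ t w₀⁻¹ = diag(d ∘ rev)` is regular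
  set t' : ↥(torusU σ J) := ⟨w₀ * (t : ↥(unitaryGroupOfForm σ J)) * w₀⁻¹, weylConj_mem_torusU σ hJ w₀ hw₀ t⟩ with ht'
  have hd' : glDiagonal 3 R (fun i => d i.rev) = ((t' : ↥(unitaryGroupOfForm σ J)) : GL (Fin 3) R) :=
    glDiagonal_rev_eq_weylConj σ hJ w₀ hw₀ t hd
  have hreg' : IsRegularElt ((t' : ↥(unitaryGroupOfForm σ J)) : GL (Fin 3) R) :=
    (isRegularElt_coe_conj_iff σ J w₀ (t : ↥(unitaryGroupOfForm σ J))).2 hreg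
  have hρ' : v (⅟(2 : R)) * v (((((fun i : Fin 3 => d i.rev) 0)⁻¹ * (fun i : Fin 3 => d i.rev) 1 : Rˣ) : R) -
      σ ((((fun i : Fin 3 => d i.rev) 0)⁻¹ * (fun i : Fin 3 => d i.rev) 1 : Rˣ) : R)) * (ρx * ρx) ≤
      v (((((fun i : Fin 3 => d i.rev) 0)⁻¹ * (fun i : Fin 3 => d i.rev) 2 : Rˣ) : R) - 1) * ρy := hρ
  have key := image_conj_box σ hσ hJ v hv t' hreg' hd' hρ'
  have hr0 : (Fin.rev 0 : Fin 3) = 2 := rfl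
  have hr1 : (Fin.rev 1 : Fin 3) = 1 := rfl
  have hr2 : (Fin.rev 2 : Fin 3) = 0 := rfl
  simp only [hr0, hr1, hr2] at key
  -- conjugate both sides of `key` by `w₀`
  have ht'v : ((t' : ↥(unitaryGroupOfForm σ J))) = w₀ * (t : ↥(unitaryGroupOfForm σ J)) * w₀⁻¹ := rfl
  have hf : (fun m' : ↥(unipotentU σ J) =>
        (w₀ * (m' : ↥(unitaryGroupOfForm σ J)) * w₀⁻¹) * t * (w₀ * (m' : ↥(unitaryGroupOfForm σ J)) * w₀⁻¹)⁻¹) =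
      (fun g : ↥(unitaryGroupOfForm σ J) => w₀ * g * w₀⁻¹) ∘
        (fun n' : ↥(unipotentU σ J) => (n' : ↥(unitaryGroupOfForm σ J)) * t' * (n' : ↥(unitaryGroupOfForm σ J))⁻¹) := by
    funext m'
    simp only [Function.comp_apply, ht'v]
    exact weylConj_mul_conj_eq σ hJ w₀ hw₀ (t : ↥(unitaryGroupOfForm σ J)) (m' : ↥(unitaryGroupOfForm σ J))
  have hg : (fun n : ↥(unipotentU σ J) => (t : ↥(unitaryGroupOfForm σ J)) * (w₀ * (n : ↥(unitaryGroupOfForm σ J)) * w₀⁻¹)) =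
      (fun g : ↥(unitaryGroupOfForm σ J) => w₀ * g * w₀⁻¹) ∘
        (fun n : ↥(unipotentU σ J) => (t' : ↥(unitaryGroupOfForm σ J)) * (n : ↥(unitaryGroupOfForm σ J))) := by
    funext n
    simp only [Function.comp_apply, ht'v]
    exact mul_weylConj_eq σ hJ w₀ hw₀ (t : ↥(unitaryGroupOfForm σ J)) (n : ↥(unitaryGroupOfForm σ J))
  rw [hf, hg, Set.image_comp, Set.image_comp, key]

include hσ hv hw₀ in
/-- **(J3⁻) THE `N⁻` BOX BIJECTION, `Set.BijOn` form**: for REGULAR `t = diag(d) ∈ T`, van Dijk's map `g ↦ t⁻¹ g t g⁻¹` restricted to `N⁻ = w₀ N w₀⁻¹` is a bijection from the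
`w₀`-conjugate of `BOX(ρx, ρy)` onto the `w₀`-conjugate of `BOX(v(a_w − 1)ρx, v(b_w − 1)ρy)` (`a_w = d₂⁻¹d₁`, `b_w = d₂⁻¹d₀`; depth condition of ★ (J3) at `(a_w, b_w)`) —
★ `bijOn_vanDijk_box` at `ʷt` transported along the injection `m ↦ w₀ m w₀⁻¹` (Mathlib `Set.bijOn_image_image`); the scaling `|det(1 − Ad t)|_{𝔫⁻}|` of the road's tube count.
[cite: HarishChandra1970, Lemma 22] [cite: vanDijk1972, §2] [cite: Rogawski1990, §12.5 p. 182] -/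
theorem bijOn_weylConj_vanDijk_box (t : ↥(torusU σ J)) (hreg : IsRegularElt ((t : ↥(unitaryGroupOfForm σ J)) : GL (Fin 3) R))
    {d : Fin 3 → Rˣ} (hd : glDiagonal 3 R d = ((t : ↥(unitaryGroupOfForm σ J)) : GL (Fin 3) R)) {ρx ρy : Γ₀}
    (hρ : v (⅟(2 : R)) * v ((((d 2)⁻¹ * d 1 : Rˣ) : R) - σ (((d 2)⁻¹ * d 1 : Rˣ) : R)) * (ρx * ρx) ≤ v ((((d 2)⁻¹ * d 0 : Rˣ) : R) - 1) * ρy) :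
    Set.BijOn (fun g : ↥(unitaryGroupOfForm σ J) => (t : ↥(unitaryGroupOfForm σ J))⁻¹ * g * t * g⁻¹)
      ((fun m' : ↥(unipotentU σ J) => w₀ * (m' : ↥(unitaryGroupOfForm σ J)) * w₀⁻¹) ''
        {m' | v (heisX σ m') ≤ ρx ∧ v (heisY σ hσ hJ m' : R) ≤ ρy})
      ((fun n : ↥(unipotentU σ J) => w₀ * (n : ↥(unitaryGroupOfForm σ J)) * w₀⁻¹) ''
        {n | v (heisX σ n) ≤ v ((((d 2)⁻¹ * d 1 : Rˣ) : R) - 1) * ρx ∧ v (heisY σ hσ hJ n : R) ≤ v ((((d 2)⁻¹ * d 0 : Rˣ) : R) - 1) * ρy}) := by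
  set t' : ↥(torusU σ J) := ⟨w₀ * (t : ↥(unitaryGroupOfForm σ J)) * w₀⁻¹, weylConj_mem_torusU σ hJ w₀ hw₀ t⟩ with ht'
  have hd' : glDiagonal 3 R (fun i => d i.rev) = ((t' : ↥(unitaryGroupOfForm σ J)) : GL (Fin 3) R) :=
    glDiagonal_rev_eq_weylConj σ hJ w₀ hw₀ t hd
  have hreg' : IsRegularElt ((t' : ↥(unitaryGroupOfForm σ J)) : GL (Fin 3) R) :=
    (isRegularElt_coe_conj_iff σ J w₀ (t : ↥(unitaryGroupOfForm σ J))).2 hreg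
  have hρ' : v (⅟(2 : R)) * v (((((fun i : Fin 3 => d i.rev) 0)⁻¹ * (fun i : Fin 3 => d i.rev) 1 : Rˣ) : R) -
      σ ((((fun i : Fin 3 => d i.rev) 0)⁻¹ * (fun i : Fin 3 => d i.rev) 1 : Rˣ) : R)) * (ρx * ρx) ≤
      v (((((fun i : Fin 3 => d i.rev) 0)⁻¹ * (fun i : Fin 3 => d i.rev) 2 : Rˣ) : R) - 1) * ρy := hρ
  have hbij := bijOn_vanDijk_box σ hσ hJ v hv t' hreg' hd' hρ'
  have hr0 : (Fin.rev 0 : Fin 3) = 2 := rfl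
  have hr1 : (Fin.rev 1 : Fin 3) = 1 := rfl
  have hr2 : (Fin.rev 2 : Fin 3) = 0 := rfl
  simp only [hr0, hr1, hr2] at hbij
  have ht'v : ((t' : ↥(unitaryGroupOfForm σ J))) = w₀ * (t : ↥(unitaryGroupOfForm σ J)) * w₀⁻¹ := rfl
  -- the square commutes: `t⁻¹ (w m w⁻¹) t (w m w⁻¹)⁻¹ = w (ʷt⁻¹ m ʷt m⁻¹) w⁻¹ = w ↑(ψ_{ʷt} m) w⁻¹`
  have comm : ∀ m : ↥(unipotentU σ J),
      (fun n : ↥(unipotentU σ J) => w₀ * (n : ↥(unitaryGroupOfForm σ J)) * w₀⁻¹) (torusConj σ t' m * m⁻¹) =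
        (fun g : ↥(unitaryGroupOfForm σ J) => (t : ↥(unitaryGroupOfForm σ J))⁻¹ * g * t * g⁻¹)
          ((fun m' : ↥(unipotentU σ J) => w₀ * (m' : ↥(unitaryGroupOfForm σ J)) * w₀⁻¹) m) := by
    intro m
    simp only [Subgroup.coe_mul, Subgroup.coe_inv, coe_torusConj, ht'v]
    exact (vanDijk_weylConj_eq σ hJ w₀ hw₀ (t : ↥(unitaryGroupOfForm σ J)) (m : ↥(unitaryGroupOfForm σ J))).symm
  -- injectivity of `m ↦ w₀ m w₀⁻¹` on `N`
  have hpinj : Function.Injective (fun n : ↥(unipotentU σ J) => w₀ * (n : ↥(unitaryGroupOfForm σ J)) * w₀⁻¹) := by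
    intro m m' h
    have h' : (m : ↥(unitaryGroupOfForm σ J)) = m' := mul_left_cancel (mul_right_cancel h)
    exact Subtype.ext h'
  refine Set.bijOn_image_image comm hbij ?_
  -- injectivity of the target map on the image: through `comm` and ★ `injOn_vanDijk`
  rintro _ ⟨m, hm, rfl⟩ _ ⟨m', hm', rfl⟩ h
  have h2 : (fun n : ↥(unipotentU σ J) => w₀ * (n : ↥(unitaryGroupOfForm σ J)) * w₀⁻¹) (torusConj σ t' m * m⁻¹) =
      (fun n : ↥(unipotentU σ J) => w₀ * (n : ↥(unitaryGroupOfForm σ J)) * w₀⁻¹) (torusConj σ t' m' * m'⁻¹) := by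
    rw [comm m, comm m', h]
  have h3 : torusConj σ t' m * m⁻¹ = torusConj σ t' m' * m'⁻¹ := hpinj h2
  have h4 : m = m' := injOn_vanDijk σ hσ hJ t' hreg' _ hm hm' h3
  rw [h4]

end Summit.HodgeConjecture.HodgeConjecture.Cruxes.H413.F0P3cStCharTSVanDijkBoxOpp
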